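import Mathlib.RingTheory.ClassGroup.Basic
import Mathlib.RingTheory.DedekindDomain.Ideal.Lemmas
import Mathlib.GroupTheory.OrderOfElement
import HarnessLib

/-!
# Endomorphisms of the class group induced by multiplicative maps of ideals, and an iteration lemma

Two pieces of bookkeeping for [Schoof2009, Theorem 14.1] (the plus argument) in the language of an
arbitrary Dedekind domain `R`:

* `ClassGroup.exists_monoidHom_mk0_eq` — a map `Φ` on ideals which is multiplicative, preserves
  nonzero ideals and sends principal ideals to principal ideals (e.g. `I ↦ ∏_σ σ(I)^{n_σ}` for ring
  automorphisms `σ`, the action of a group-ring element) induces an endomorphism `Θ` of `Cl(R)` with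
  `Θ [I] = [Φ I]`;
* `ClassGroup.iterate_card_apply_eq_one` (and `iterate_apply_eq_one_of_card_le`) — if an
  endomorphism `Θ` of a finite
  commutative group maps every element to a `q`-th power, then `Θ^{#G}` kills the `q`-torsion
  (`Θ^N x = z_N^{q^N}` with `z_N` of `q`-power order dividing `#G < q^{#G}`).  This replaces the use of
  [Schoof2009, Proposition 13.2] ("`Cl[q] ≅ Cl/qCl`, so an annihilator of `Cl/Cl^q` annihilates
  `Cl[q]`") when only *some* nonzero annihilator is needed: if `θ` annihilates `Cl/Cl^q` then
  `θ^{#Cl}` annihilates `Cl[q]`.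

## References

* R. Schoof, *Catalan's Conjecture*, Universitext, Springer 2009, Ch. 13 Prop. 13.2 and Ch. 14,
  proof of Theorem 14.1 (book pp. 86, 92–93). [Schoof2009]
-/

open nonZeroDivisors

namespace Literature.NumberTheory.NumberFields.ClassGroup

/-! ### Endomorphisms of `Cl(R)` from multiplicative maps of ideals -/

section Endo

variable {R : Type*} [CommRing R] [IsDedekindDomain R]

/-- A multiplicative self-map of the nonzero ideals of a Dedekind domain fixes `⊤`
(`Φ ⊤ = Φ ⊤ · Φ ⊤` and nonzero ideals cancel). [folklore] -/
theorem map_top_eq_top_of_mul (Φ : Ideal R → Ideal R) (hmul : ∀ I J, Φ (I * J) = Φ I * Φ J)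
    (hne : ∀ I, I ≠ ⊥ → Φ I ≠ ⊥) : Φ ⊤ = ⊤ := by
  have h1 : Φ ⊤ * Φ ⊤ = Φ ⊤ * ⊤ := by rw [Ideal.mul_top, ← hmul, Ideal.top_mul]
  exact mul_left_cancel₀ (hne ⊤ top_ne_bot) h1

/-- **A multiplicative, nonzero-preserving, principal-preserving map of ideals induces an
endomorphism of the class group**: `Θ [I] = [Φ I]`.  (Used with `Φ I = ∏_σ σ(I)^{n_σ}`, the action of
an element of the integral group ring of a group of automorphisms, [Schoof2009, Ch. 7 and Ch. 14]:
"all groups defined so far are modules over the group ring `ℤ[G]`".) [cite: Schoof2009, Ch. 7 (p. 38, `ℤ[G]`-modules) and Ch. 14]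
-/
theorem exists_monoidHom_mk0_eq (Φ : Ideal R → Ideal R) (hmul : ∀ I J, Φ (I * J) = Φ I * Φ J)
    (hne : ∀ I, I ≠ ⊥ → Φ I ≠ ⊥)
    (hprin : ∀ x : R, x ≠ 0 → ∃ y : R, y ≠ 0 ∧ Φ (Ideal.span {x}) = Ideal.span {y}) :
    ∃ Θ : _root_.ClassGroup R →* _root_.ClassGroup R, ∀ (I : Ideal R) (hI : I ≠ ⊥),
      Θ (ClassGroup.mk0 ⟨I, mem_nonZeroDivisors_iff_ne_zero.mpr hI⟩) =
        ClassGroup.mk0 ⟨Φ I, mem_nonZeroDivisors_iff_ne_zero.mpr (hne I hI)⟩ := by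
  classical
  -- `Θ₀ : (Ideal R)⁰ →* Cl(R)`, `I ↦ [Φ I]`
  have hmem : ∀ I : (Ideal R)⁰, Φ I ∈ (Ideal R)⁰ := fun I =>
    mem_nonZeroDivisors_iff_ne_zero.mpr (hne I (mem_nonZeroDivisors_iff_ne_zero.mp I.2))
  set Θ₀ : (Ideal R)⁰ →* _root_.ClassGroup R :=
    { toFun := fun I => ClassGroup.mk0 ⟨Φ I, hmem I⟩
      map_one' := by
        have h1 : (⟨Φ ((1 : (Ideal R)⁰) : Ideal R), hmem 1⟩ : (Ideal R)⁰) = 1 := by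
          apply Subtype.ext
          change Φ ((1 : (Ideal R)⁰) : Ideal R) = ((1 : (Ideal R)⁰) : Ideal R)
          rw [OneMemClass.coe_one, Ideal.one_eq_top]
          exact map_top_eq_top_of_mul Φ hmul hne
        simp only [h1, map_one]
      map_mul' := fun I J => by
        simp only [← map_mul]
        congr 1
        exact Subtype.ext (hmul I J) } with hΘ₀
  have hΘ₀_apply : ∀ I : (Ideal R)⁰, Θ₀ I = ClassGroup.mk0 ⟨Φ I, hmem I⟩ := fun I => rfl
  -- `Θ₀` is constant on the fibres of `mk0`
  have hfib : ∀ I J : (Ideal R)⁰, ClassGroup.mk0 I = ClassGroup.mk0 J → Θ₀ I = Θ₀ J := by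
    intro I J h
    obtain ⟨x, y, hx, hy, hxy⟩ := ClassGroup.mk0_eq_mk0_iff.mp h
    obtain ⟨x', hx', hΦx⟩ := hprin x hx
    obtain ⟨y', hy', hΦy⟩ := hprin y hy
    rw [hΘ₀_apply, hΘ₀_apply, ClassGroup.mk0_eq_mk0_iff]
    refine ⟨x', y', hx', hy', ?_⟩
    change Ideal.span {x'} * Φ I = Ideal.span {y'} * Φ J
    rw [← hΦx, ← hΦy, ← hmul, ← hmul, hxy]
  -- descend along the surjection `mk0`
  set rep : _root_.ClassGroup R → (Ideal R)⁰ := fun c => Classical.choose (ClassGroup.mk0_surjective c)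
    with hrep
  have hrep_spec : ∀ c, ClassGroup.mk0 (rep c) = c := fun c =>
    Classical.choose_spec (ClassGroup.mk0_surjective c)
  have hkey : ∀ I : (Ideal R)⁰, Θ₀ (rep (ClassGroup.mk0 I)) = Θ₀ I := fun I =>
    hfib _ _ (hrep_spec _)
  refine ⟨{ toFun := fun c => Θ₀ (rep c)
            map_one' := by
              have := hkey 1
              rw [map_one] at this
              rw [this, map_one]
            map_mul' := fun a b => by
              obtain ⟨I, rfl⟩ := ClassGroup.mk0_surjective a
              obtain ⟨J, rfl⟩ := ClassGroup.mk0_surjective b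
              rw [← map_mul, hkey, hkey, hkey, map_mul] }, fun I hI => ?_⟩
  change Θ₀ (rep (ClassGroup.mk0 _)) = _
  rw [hkey]
  rfl

end Endo

/-! ### Iteration: `Θ` with values in the `q`-th powers kills the `q`-torsion after `#G` steps -/

section Iterate

variable {G : Type*} [CommGroup G] [Finite G]

omit [Finite G] in
/-- `Θ^[N] x = z^{q^N}` for some `z` with `z^{q^{N+1}} = 1`, when `x^q = 1` and every value of `Θ`
is a `q`-th power. [folklore] -/
theorem exists_iterate_apply_eq_pow (Θ : G →* G) (q : ℕ) (hΘ : ∀ y : G, ∃ z : G, Θ y = z ^ q)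
    {x : G} (hx : x ^ q = 1) (N : ℕ) :
    ∃ z : G, (Θ^[N]) x = z ^ q ^ N ∧ z ^ q ^ (N + 1) = 1 := by
  induction N with
  | zero => exact ⟨x, by rw [Function.iterate_zero, id, pow_zero, pow_one], by rwa [zero_add, pow_one]⟩
  | succ N ih =>
    obtain ⟨z, hz, hzq⟩ := ih
    obtain ⟨z', hz'⟩ := hΘ z
    refine ⟨z', ?_, ?_⟩
    · rw [Function.iterate_succ_apply', hz, map_pow, hz', ← pow_mul, ← pow_succ']
    · -- `z'^{q^{N+2}} = Θ(z^{q^{N+1}})`, and `Θ^[N+1] x` is `q`-torsion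
      have h1 : z' ^ q ^ (N + 1 + 1) = Θ (z ^ q ^ (N + 1)) := by
        rw [map_pow, hz', ← pow_mul, ← pow_succ']
      rw [h1, hzq, map_one]

/-- **Iteration lemma.**  Let `Θ` be an endomorphism of a finite commutative group `G` such that
every `Θ y` is a `q`-th power (`q` prime).  Then `Θ^[#G] x = 1` for every `x` with `x^q = 1`: indeed
`Θ^[N] x = z^{q^N}` with `z` of order dividing both `q^{N+1}` and `#G < q^{#G}`.  (A substitute for
[Schoof2009, Prop. 13.2]: an annihilator `θ` of `Cl/Cl^q` need not annihilate `Cl[q]`, but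
`θ^{#Cl}` does.) [cite: Schoof2009, Proposition 13.2 and Ch. 14 (proof of Theorem 14.1)] -/
theorem iterate_card_apply_eq_one (Θ : G →* G) {q : ℕ} (hq : q.Prime)
    (hΘ : ∀ y : G, ∃ z : G, Θ y = z ^ q) {x : G} (hx : x ^ q = 1) :
    (Θ^[Nat.card G]) x = 1 := by
  classical
  haveI := Fact.mk hq
  set h := Nat.card G with hh
  obtain ⟨z, hz, hzq⟩ := exists_iterate_apply_eq_pow Θ q hΘ hx h
  rw [hz]
  -- the order of `z` is a power `q^j` dividing `#G`, so `q^j ≤ #G < q^#G` and `j < #G`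
  have hord : orderOf z ∣ q ^ (h + 1) := orderOf_dvd_of_pow_eq_one hzq
  obtain ⟨j, hj, hjord⟩ := (Nat.dvd_prime_pow hq).mp hord
  have hdvd : orderOf z ∣ h := orderOf_dvd_natCard z
  have hpos : 0 < h := Nat.card_pos
  have hjle : q ^ j ≤ h := by
    rw [← hjord]
    exact Nat.le_of_dvd hpos hdvd
  have hjlt : j < h := by
    by_contra hle
    push Not at hle
    have : q ^ h ≤ q ^ j := Nat.pow_le_pow_right hq.pos hle
    have : h < q ^ h := Nat.lt_pow_self hq.one_lt
    omega
  apply orderOf_dvd_iff_pow_eq_one.mp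
  rw [hjord]
  exact pow_dvd_pow q hjlt.le

/-- The same for the `N`-th iterate, any `N ≥ #G`. [folklore] -/
theorem iterate_apply_eq_one_of_card_le (Θ : G →* G) {q : ℕ} (hq : q.Prime)
    (hΘ : ∀ y : G, ∃ z : G, Θ y = z ^ q) {x : G} (hx : x ^ q = 1) {N : ℕ} (hN : Nat.card G ≤ N) :
    (Θ^[N]) x = 1 := by
  obtain ⟨d, rfl⟩ := Nat.exists_eq_add_of_le hN
  rw [add_comm, Function.iterate_add_apply, iterate_card_apply_eq_one Θ hq hΘ hx]
  clear hN
  induction d with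
  | zero => rfl
  | succ d ih => rw [Function.iterate_succ_apply', ih, map_one]

end Iterate

end Literature.NumberTheory.NumberFields.ClassGroup
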